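import Summits.BirchSwinnertonDyer.BirchSwinnertonDyer.Theses.AdditiveKolyvaginRoad
import Summits.BirchSwinnertonDyer.BirchSwinnertonDyer.Theorems.AdditiveKolyvaginRoadLevelKolyvaginSystemsAdditivePoitouTateFree
import Summits.BirchSwinnertonDyer.BirchSwinnertonDyer.Theorems.AdditiveKolyvaginRoadKolyvaginPrimitiveSelfCertificate

/-! # LevelKolyvaginSystemsAdditive — line `epsilon-matched-retyping`, skeleton v15 (lead cruxlead-21396 g6, 2026-08-28; v14 81bf4b5c479ee443 registered 12:57Z, v15 = v14 with the width landings p634919 ∕ p635192 cited BY NAME)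

Crux item stmt-BirchSwinnertonDyer-21396 (KS′), route `AdditiveKolyvaginRoad`:
`Summit.BirchSwinnertonDyer.BirchSwinnertonDyer.Theses.AdditiveKolyvaginRoad.LevelKolyvaginSystemsAdditive`.

HISTORY. v1 (7 stubs) → … → v12 (width seat akr-p2x-w2 g6, 31a1d0c9a47cd08f; re-stamped by leads g4, g5): TWO stubs — S1″
`stub_kolyvaginPrimitiveOffGoodAvatarLocusSlim` (KPA′'s conclusion at the ♯ frames OFF the slim good-avatar locus, research) and S0′
`stub_publishedInputsEpsilonSlim` (Kriz–Li 1.16 ∧ PUB ∧ DUAL, cite-only).  v13 (akr-p2x-w2 g7, announced 12:36Z, not registered): residual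
re-read «above the bottom» through E's own self-certificate, Kriz–Li eliminated (part 1 LANDED: p634919 `…KolyvaginPrimitiveSelfCertificate`).
v14 ∕ v15 (this file) is the FULL DEFLATION of the line (v15 = v14 re-wired onto the landed width files, same registered stub text):

* ONE STUB, NO CITE-ONLY STUB.  S1‴ `stub_kolyvaginPrimitiveAboveBottom` := KPA′'s conclusion (a Kolyvagin–Heegner datum of Kolyvagin-prime
  support with `c(1) ≠ 0` in `H¹(K, E[p])`, i.e. `c_1(n) ≠ 0` for some `n ∈ Λ`) at the ♯ frames ABOVE THE BOTTOM: those where EVERY conductor-1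
  Kolyvagin–Heegner datum has `c_1(1) = 0` (the Kummer image of `y_K = P(1)` vanishes mod `p`).  This is where Kolyvagin's conjecture mod `p`
  has content; at the other frames the datum `d₁` itself is the witness (`n = 1`, `kolSupp_one`) — pure logic, no named fact.
* THE DOOR IS INPUT-FREE AND LANDED.  `AdditiveKoly.levelKolyvaginSystemsAdditive_of_kolyvaginPrimitiveAdditive_free : KolyvaginPrimitiveAdditive →
  LevelKolyvaginSystemsAdditive` (akr-p2x-w4 g2, p635192 ✓: akr-p2x-w5 g0's door p630671 — `exists_transverseLevelSpaces` + `dich_of_poitouTate` +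
  `nonempty_levelKolyvaginSystemP_of_selmerDichotomy` — run on the TREE THEOREM `SchneiderFreeAdditiveX3.PoitouTateReduction.poitouTate_selmerStructure_duality_holds`,
  cell bsd-schneider door-c4 g18, p624636: Milne ADT I 4.10 (b), kernel-checked).  So PUB (item 20137), DUAL (item 21333) and Kriz–Li 1.16 ALL
  LEAVE THE LINE: v12's by_cases on the good-avatar locus is subsumed (modulo Kriz–Li the avatar certificate gives E's own `c(1) ≠ 0` — akr-p2x-w2
  g7's (B), landed as `heegnerPoint_not_pDiv_on_goodAvatarLocus_of_thm116`, p634919 ✓ — and those frames are covered here unconditionally; the frame-wise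
  form is `nonempty_levelKolyvaginSystemP_of_kolyvaginClass_ne_zero_free` ∕ `nonempty_levelKolyvaginSystemP_of_selfCertificate` below).

STUBS (1): S1‴ `stub_kolyvaginPrimitiveAboveBottom` (RESIDUAL = research: Kolyvagin's conjecture mod `p` above the bottom at an additive prime
`p ≥ 5`; ≡ crux r2 KPA′ stmt-BirchSwinnertonDyer-21400 BY NAME with ZERO inputs — `stub_kolyvaginPrimitiveAboveBottom_of_kolyvaginPrimitiveAdditive`
and `kolyvaginPrimitiveAdditive_of_stub` below; in print only for `p ∤ N`: W. Zhang 2014 Thm. 1.1 at good ordinary `p`).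

COMPOSITION `LevelKolyvaginSystemsAdditive_of`: the crux BY NAME — `kolyvaginPrimitiveAdditive_of_stub` (at a frame, `by_cases` on
`∃ d₁, d₁.kolyvaginClass hp 1 ≠ 0`; yes: akr-p2x-w2 g7's trivial door `kolyvaginPrimitiveAdditive_conclusion_of_bottom` (p634919); no: S1‴) gives
KPA′, and akr-p2x-w4 g2's input-free door (p635192) gives KS′.
BOOKKEEPING (no sorry): S1‴ ⟸ KPA′ (restriction); KPA′ ⟸ S1‴ (the split) — so `S1‴ ↔ KolyvaginPrimitiveAdditive` with NO named fact;
S1‴ ⟸ PUB → CT → KS′ (exactness, via p635192's converse `kolyvaginPrimitiveAdditive_of_casselsTate_of_levelSystems`: parity, Gross–Zagier–Kolyvagin and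
the levelwise Cassels–Tate fact are the only named facts left anywhere near this item, and only in the converse direction); the frame-wise input-free
socket and the SELF-CERTIFIED covered locus (`nonempty_levelKolyvaginSystemP_of_selfCertificate`: KS′'s fibre at every ♯ frame whose own Heegner point
is not `p`-divisible in `E(ℚ_p)` — p634919's door (A) ∘ the socket — NO named fact).

HONEST FRAMING: a skeleton; 1 `sorry`, inside the registered `stub_*`; closes nothing.  Frames COVERED with NO named fact: every ♯ frame at which
some conductor-1 datum has `c(1) ≠ 0`.  BSD is not proved by any of this; KS′ (∀ frames) is not proved by any of this; above the bottom
KS′ ≡ KPA′ is OPEN research (no refereed rank-0 anchor ∕ main-conjecture divisibility at `p² ∣ N`).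
-/

set_option linter.dupNamespace false
set_option autoImplicit false

noncomputable section

open scoped Classical

open WeierstrassCurve NumberField IsDedekindDomain Field
  Literature.NumberTheory.EllipticCurves Literature.NumberTheory.EllipticCurves.ModularForms
  Literature.NumberTheory.EllipticCurves.Rank1Residual Literature.NumberTheory.GaloisRepresentations
  Literature.NumberTheory.GaloisCohomology
  Summit.BirchSwinnertonDyer.BirchSwinnertonDyer.Theses.AdditiveKolyvaginRoad
  Summit.BirchSwinnertonDyer.BirchSwinnertonDyer.Theorems.AdditiveKoly
  Summit.BirchSwinnertonDyer.Rank1Residual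

namespace Summit.BirchSwinnertonDyer.BirchSwinnertonDyer.Cruxes.LevelKolyvaginSystemsAdditive.EpsilonMatchedRetyping

/-- stub S1‴ (RESIDUAL, research; not closable on this line): the CONCLUSION OF CRUX r2 KPA′ (`KolyvaginPrimitiveAdditive`,
stmt-BirchSwinnertonDyer-21400) at the ♯ frames ABOVE THE BOTTOM — frames `(E, p, K, Dt, β, ι)` at which every conductor-1 Kolyvagin–Heegner
datum has `c_1(1) = 0` in `H¹(K, E[p])` (the Kummer image of `y_K` vanishes mod `p`; BSD-conjecturally the frames with `Ш(E/K)[p] ≠ 0`):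
SOME Kolyvagin–Heegner datum of Kolyvagin-prime support has `c_1(n) ≠ 0`.  Kolyvagin's conjecture mod `p` at an additive prime `p ≥ 5` where it
has content; a literal restriction of 21400 (`stub_kolyvaginPrimitiveAboveBottom_of_kolyvaginPrimitiveAdditive`) and EQUIVALENT to it with no
input (`kolyvaginPrimitiveAdditive_of_stub`).  In print only for `p ∤ N` (W. Zhang, Camb. J. Math. 2 (2014), Thm. 1.1: good ordinary `p`). -/
theorem stub_kolyvaginPrimitiveAboveBottom (W : WeierstrassCurve ℚ) [W.IsElliptic] [W.IsGloballyMinimal] [NeZero (W.conductorNorm ℤ)]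
    (p : ℕ) [Fact p.Prime] (K : Type) [Field K] [NumberField K]
    (Dt : ModularParametrizationData W (W.conductorNorm ℤ)) (β : ℤ) (ι : K →+* ℂ) :
    5 ≤ p → Addv W p → W.HasSurjectiveModNGaloisRep p →
    (∀ (ℓ : ℕ) [Fact ℓ.Prime], W.HasMultiplicativeReductionAtPrime ℓ → ¬ p ∣ padicValInt ℓ W.minimalDiscriminantInt) →
    (∃ (ℓ₁ ℓ₂ : ℕ) (_ : Fact ℓ₁.Prime) (_ : Fact ℓ₂.Prime), ℓ₁ ≠ ℓ₂ ∧
      W.HasMultiplicativeReductionAtPrime ℓ₁ ∧ W.HasMultiplicativeReductionAtPrime ℓ₂) →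
    ¬ p ∣ W.tamagawaProduct → W.analyticRank = 1 → IsImaginaryQuadratic K → Odd (NumberField.discr K) →
    NumberField.discr K < -4 → SatisfiesHeegnerHypothesis (W.conductorNorm ℤ) K →
    (W.quadraticTwist (NumberField.discr K : ℚ)).entireLFunction 1 ≠ 0 →
    (4 * (W.conductorNorm ℤ : ℤ)) ∣ β ^ 2 - NumberField.discr K → ¬ (p : ℤ) ∣ Dt.c →
    (∀ d₁ : KolyvaginHeegnerData Dt β ι 1, d₁.kolyvaginClass (Fact.out : p.Prime) 1 = 0) →
    ∃ (n : ℕ) (d : KolyvaginHeegnerData Dt β ι n),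
      KolyvaginDescent.KolSupp (Zhang2014.IsKolyvaginPrime (W.conductorNorm ℤ) W K p) n ∧
        d.kolyvaginClass (Fact.out : p.Prime) 1 ≠ 0 := by
  sorry

/-- THE SPLIT AT THE BOTTOM (pure logic, no named fact): at any frame, KPA′'s conclusion follows from S1‴ — either some conductor-1 datum has
`c_1(1) ≠ 0` and is itself the witness (akr-p2x-w2 g7's trivial door `kolyvaginPrimitiveAdditive_conclusion_of_bottom`, p634919: `n = 1` has
Kolyvagin-prime support vacuously), or the frame is above the bottom. -/
theorem kolyvaginPrimitive_conclusion_of_aboveBottom {W : WeierstrassCurve ℚ} [W.IsElliptic] [W.IsGloballyMinimal]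
    [NeZero (W.conductorNorm ℤ)] {p : ℕ} [Fact p.Prime] {K : Type} [Field K] [NumberField K]
    {Dt : ModularParametrizationData W (W.conductorNorm ℤ)} {β : ℤ} {ι : K →+* ℂ}
    (h : (∀ d₁ : KolyvaginHeegnerData Dt β ι 1, d₁.kolyvaginClass (Fact.out : p.Prime) 1 = 0) →
      ∃ (n : ℕ) (d : KolyvaginHeegnerData Dt β ι n),
        KolyvaginDescent.KolSupp (Zhang2014.IsKolyvaginPrime (W.conductorNorm ℤ) W K p) n ∧
          d.kolyvaginClass (Fact.out : p.Prime) 1 ≠ 0) :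
    ∃ (n : ℕ) (d : KolyvaginHeegnerData Dt β ι n),
      KolyvaginDescent.KolSupp (Zhang2014.IsKolyvaginPrime (W.conductorNorm ℤ) W K p) n ∧
        d.kolyvaginClass (Fact.out : p.Prime) 1 ≠ 0 := by
  by_cases hbot : ∃ d₁ : KolyvaginHeegnerData Dt β ι 1, d₁.kolyvaginClass (Fact.out : p.Prime) 1 ≠ 0
  · exact kolyvaginPrimitiveAdditive_conclusion_of_bottom W p K Dt β ι hbot
  · push Not at hbot
    exact h hbot

/-- THE INPUT-FREE FRAME-WISE SOCKET: at a ♯-type frame (`p ≥ 5`, `ρ̄_{E,p}` onto, `K` imaginary quadratic with `d_K` odd `< −4`, Heegner for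
`N_E`, `4N ∣ β² − d_K`), KPA′'s conclusion at the frame gives KS′'s fibre there — a level Kolyvagin system for every complex conjugation `c ≠ 1`
and every `ZMod p`-structure on `H¹(K, E[p])`.  The composition of akr-p2x-w5 g0's door (p630671: canonical transverse level spaces, the Selmer
dichotomies from Poitou–Tate, the synthetic system) with the TREE THEOREM `poitouTate_selmerStructure_duality_holds` (p624636) — no PUB, no
DUAL, no Kriz–Li. -/
theorem nonempty_levelKolyvaginSystemP_of_kolyvaginClass_ne_zero_free
    (W : WeierstrassCurve ℚ) [W.IsElliptic] [W.IsGloballyMinimal] [NeZero (W.conductorNorm ℤ)]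
    (p : ℕ) [Fact p.Prime] (K : Type) [Field K] [NumberField K]
    (Dt : ModularParametrizationData W (W.conductorNorm ℤ)) (β : ℤ) (ι : K →+* ℂ)
    (h5 : 5 ≤ p) (hsurj : W.HasSurjectiveModNGaloisRep p) (hK : IsImaginaryQuadratic K) (hodd : Odd (NumberField.discr K))
    (hlt : NumberField.discr K < -4) (hH : SatisfiesHeegnerHypothesis (W.conductorNorm ℤ) K)
    (hβ : (4 * (W.conductorNorm ℤ : ℤ)) ∣ β ^ 2 - NumberField.discr K)
    (hKPA : ∃ (n : ℕ) (d : KolyvaginHeegnerData Dt β ι n),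
      KolyvaginDescent.KolSupp (Zhang2014.IsKolyvaginPrime (W.conductorNorm ℤ) W K p) n ∧
        d.kolyvaginClass (Fact.out : p.Prime) 1 ≠ 0)
    (c : K ≃ₐ[ℚ] K) (hc1 : c ≠ 1) [Module (ZMod p) (Vp W K p)] :
    Nonempty (LevelKolyvaginSystemP W K p Dt β ι c) := by
  obtain ⟨𝒮, h𝒮, hfin⟩ := exists_transverseLevelSpaces W K p ι c
  obtain ⟨hLower, hRaise, hTwo⟩ := dich_of_poitouTate
    (fun K _ _ ↦
      Summit.BirchSwinnertonDyer.BirchSwinnertonDyer.Theorems.SchneiderFreeAdditiveX3.PoitouTateReduction.poitouTate_selmerStructure_duality_holds K)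
    W p K ι c h5 hsurj hK hodd hlt hc1 𝒮 h𝒮
  exact nonempty_levelKolyvaginSystemP_of_selmerDichotomy W K p Dt β ι c hK hH hβ 𝒮 h𝒮 hfin hLower hRaise hTwo hKPA

/-- BOOKKEEPING 1 (no sorry): the residual S1‴ is a RESTRICTION of crux r2 KPA′ (stmt-BirchSwinnertonDyer-21400) BY NAME — when 21400 lands,
S1‴ follows by this lemma and item 21396 closes mechanically with NO further input. -/
theorem stub_kolyvaginPrimitiveAboveBottom_of_kolyvaginPrimitiveAdditive (hKPA : KolyvaginPrimitiveAdditive)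
    (W : WeierstrassCurve ℚ) [W.IsElliptic] [W.IsGloballyMinimal] [NeZero (W.conductorNorm ℤ)]
    (p : ℕ) [Fact p.Prime] (K : Type) [Field K] [NumberField K]
    (Dt : ModularParametrizationData W (W.conductorNorm ℤ)) (β : ℤ) (ι : K →+* ℂ) :
    5 ≤ p → Addv W p → W.HasSurjectiveModNGaloisRep p →
    (∀ (ℓ : ℕ) [Fact ℓ.Prime], W.HasMultiplicativeReductionAtPrime ℓ → ¬ p ∣ padicValInt ℓ W.minimalDiscriminantInt) →
    (∃ (ℓ₁ ℓ₂ : ℕ) (_ : Fact ℓ₁.Prime) (_ : Fact ℓ₂.Prime), ℓ₁ ≠ ℓ₂ ∧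
      W.HasMultiplicativeReductionAtPrime ℓ₁ ∧ W.HasMultiplicativeReductionAtPrime ℓ₂) →
    ¬ p ∣ W.tamagawaProduct → W.analyticRank = 1 → IsImaginaryQuadratic K → Odd (NumberField.discr K) →
    NumberField.discr K < -4 → SatisfiesHeegnerHypothesis (W.conductorNorm ℤ) K →
    (W.quadraticTwist (NumberField.discr K : ℚ)).entireLFunction 1 ≠ 0 →
    (4 * (W.conductorNorm ℤ : ℤ)) ∣ β ^ 2 - NumberField.discr K → ¬ (p : ℤ) ∣ Dt.c →
    (∀ d₁ : KolyvaginHeegnerData Dt β ι 1, d₁.kolyvaginClass (Fact.out : p.Prime) 1 = 0) →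
    ∃ (n : ℕ) (d : KolyvaginHeegnerData Dt β ι n),
      KolyvaginDescent.KolSupp (Zhang2014.IsKolyvaginPrime (W.conductorNorm ℤ) W K p) n ∧
        d.kolyvaginClass (Fact.out : p.Prime) 1 ≠ 0 := by
  intro hp hadd hs hsp htwo htam hr hK hodd hlt hH hL hβ hc _
  exact hKPA W p K Dt β ι hp hadd hs hsp htwo htam hr hK hodd hlt hH hL hβ hc

/-- BOOKKEEPING 2 (no sorry, no named fact): crux r2 KPA′ follows from S1‴ by the split at the bottom — with BOOKKEEPING 1, S1‴ and
`KolyvaginPrimitiveAdditive` are EQUIVALENT with no input (`stub_kolyvaginPrimitiveAboveBottom_iff_kolyvaginPrimitiveAdditive`). -/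
theorem kolyvaginPrimitiveAdditive_of_stub
    (hS : ∀ (W : WeierstrassCurve ℚ) [W.IsElliptic] [W.IsGloballyMinimal] [NeZero (W.conductorNorm ℤ)]
      (p : ℕ) [Fact p.Prime] (K : Type) [Field K] [NumberField K]
      (Dt : ModularParametrizationData W (W.conductorNorm ℤ)) (β : ℤ) (ι : K →+* ℂ),
      5 ≤ p → Addv W p → W.HasSurjectiveModNGaloisRep p →
      (∀ (ℓ : ℕ) [Fact ℓ.Prime], W.HasMultiplicativeReductionAtPrime ℓ → ¬ p ∣ padicValInt ℓ W.minimalDiscriminantInt) →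
      (∃ (ℓ₁ ℓ₂ : ℕ) (_ : Fact ℓ₁.Prime) (_ : Fact ℓ₂.Prime), ℓ₁ ≠ ℓ₂ ∧
        W.HasMultiplicativeReductionAtPrime ℓ₁ ∧ W.HasMultiplicativeReductionAtPrime ℓ₂) →
      ¬ p ∣ W.tamagawaProduct → W.analyticRank = 1 → IsImaginaryQuadratic K → Odd (NumberField.discr K) →
      NumberField.discr K < -4 → SatisfiesHeegnerHypothesis (W.conductorNorm ℤ) K →
      (W.quadraticTwist (NumberField.discr K : ℚ)).entireLFunction 1 ≠ 0 →
      (4 * (W.conductorNorm ℤ : ℤ)) ∣ β ^ 2 - NumberField.discr K → ¬ (p : ℤ) ∣ Dt.c →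
      (∀ d₁ : KolyvaginHeegnerData Dt β ι 1, d₁.kolyvaginClass (Fact.out : p.Prime) 1 = 0) →
      ∃ (n : ℕ) (d : KolyvaginHeegnerData Dt β ι n),
        KolyvaginDescent.KolSupp (Zhang2014.IsKolyvaginPrime (W.conductorNorm ℤ) W K p) n ∧
          d.kolyvaginClass (Fact.out : p.Prime) 1 ≠ 0) :
    KolyvaginPrimitiveAdditive := by
  intro W _ _ _ p _ K _ _ Dt β ι hp hadd hs hsp htwo htam hr hK hodd hlt hH hL hβ hc
  exact kolyvaginPrimitive_conclusion_of_aboveBottom (hS W p K Dt β ι hp hadd hs hsp htwo htam hr hK hodd hlt hH hL hβ hc)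

/-- BOOKKEEPING 3 (no sorry): the residual S1‴ is EXACT — implied by the crux KS′ itself together with the published inputs PUB (item 20137)
and the levelwise Cassels–Tate fact alone (akr-p2x-w4 g2's converse `AdditiveKoly.kolyvaginPrimitiveAdditive_of_casselsTate_of_levelSystems :
PUB → CT → KS′ → KPA′`, p635192 — the Poitou–Tate conjunct of DUAL being a theorem — then restriction).  The converse direction is the only place
where named facts still enter (parity, Gross–Zagier–Kolyvagin, Cassels–Tate). -/
theorem stub_kolyvaginPrimitiveAboveBottom_necessary (hPUB : PublishedInputsAdditiveKoly)
    (hCT : ∀ (K : Type) [Field K] [NumberField K], casselsTate_levelInputs K)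
    (hKS : Summit.BirchSwinnertonDyer.BirchSwinnertonDyer.Theses.AdditiveKolyvaginRoad.LevelKolyvaginSystemsAdditive)
    (W : WeierstrassCurve ℚ) [W.IsElliptic] [W.IsGloballyMinimal] [NeZero (W.conductorNorm ℤ)]
    (p : ℕ) [Fact p.Prime] (K : Type) [Field K] [NumberField K]
    (Dt : ModularParametrizationData W (W.conductorNorm ℤ)) (β : ℤ) (ι : K →+* ℂ) :
    5 ≤ p → Addv W p → W.HasSurjectiveModNGaloisRep p →
    (∀ (ℓ : ℕ) [Fact ℓ.Prime], W.HasMultiplicativeReductionAtPrime ℓ → ¬ p ∣ padicValInt ℓ W.minimalDiscriminantInt) →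
    (∃ (ℓ₁ ℓ₂ : ℕ) (_ : Fact ℓ₁.Prime) (_ : Fact ℓ₂.Prime), ℓ₁ ≠ ℓ₂ ∧
      W.HasMultiplicativeReductionAtPrime ℓ₁ ∧ W.HasMultiplicativeReductionAtPrime ℓ₂) →
    ¬ p ∣ W.tamagawaProduct → W.analyticRank = 1 → IsImaginaryQuadratic K → Odd (NumberField.discr K) →
    NumberField.discr K < -4 → SatisfiesHeegnerHypothesis (W.conductorNorm ℤ) K →
    (W.quadraticTwist (NumberField.discr K : ℚ)).entireLFunction 1 ≠ 0 →
    (4 * (W.conductorNorm ℤ : ℤ)) ∣ β ^ 2 - NumberField.discr K → ¬ (p : ℤ) ∣ Dt.c →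
    (∀ d₁ : KolyvaginHeegnerData Dt β ι 1, d₁.kolyvaginClass (Fact.out : p.Prime) 1 = 0) →
    ∃ (n : ℕ) (d : KolyvaginHeegnerData Dt β ι n),
      KolyvaginDescent.KolSupp (Zhang2014.IsKolyvaginPrime (W.conductorNorm ℤ) W K p) n ∧
        d.kolyvaginClass (Fact.out : p.Prime) 1 ≠ 0 :=
  stub_kolyvaginPrimitiveAboveBottom_of_kolyvaginPrimitiveAdditive
    (kolyvaginPrimitiveAdditive_of_casselsTate_of_levelSystems hPUB hCT hKS) W p K Dt β ι

/-- COMPOSITION (kernel-checked, no sorry of its own, NO named fact): the crux BY NAME — S1‴ gives crux r2 KPA′ by the split at the bottom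
(`kolyvaginPrimitiveAdditive_of_stub`), and akr-p2x-w4 g2's LANDED input-free door
`AdditiveKoly.levelKolyvaginSystemsAdditive_of_kolyvaginPrimitiveAdditive_free` (p635192) gives KS′. -/
theorem LevelKolyvaginSystemsAdditive_of :
    Summit.BirchSwinnertonDyer.BirchSwinnertonDyer.Theses.AdditiveKolyvaginRoad.LevelKolyvaginSystemsAdditive :=
  levelKolyvaginSystemsAdditive_of_kolyvaginPrimitiveAdditive_free (kolyvaginPrimitiveAdditive_of_stub stub_kolyvaginPrimitiveAboveBottom)

/-- THE COVERED LOCUS, frame-wise, NO named fact: at every ♯-type frame carrying E's OWN self-certificate — some Heegner point `y` of `E` over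
`heegnerPointComplex Dt H` with `β(H) = β` that is not `p`-divisible in `E(ℚ_p)` along some `ιp` (akr-p2x-w2 g7's door (A), p634919:
`kolyvaginPrimitiveAdditive_conclusion_of_selfCertificate`) — KS′'s fibre holds: a level Kolyvagin system for every complex conjugation `c ≠ 1`
and every `ZMod p`-structure.  (The ♯ binders not used by the door are carried for the shape.)  This ⊇ v12's good-avatar-with-certificate locus
(modulo Kriz–Li, `heegnerPoint_not_pDiv_on_goodAvatarLocus_of_thm116`) and needs nothing. -/
theorem nonempty_levelKolyvaginSystemP_of_selfCertificate
    (W : WeierstrassCurve ℚ) [W.IsElliptic] [W.IsGloballyMinimal] [NeZero (W.conductorNorm ℤ)]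
    (p : ℕ) [Fact p.Prime] (K : Type) [Field K] [NumberField K]
    (Dt : ModularParametrizationData W (W.conductorNorm ℤ)) (β : ℤ) (ι : K →+* ℂ)
    (h5 : 5 ≤ p) (hadd : Addv W p) (hsurj : W.HasSurjectiveModNGaloisRep p)
    (hsp : ∀ (ℓ : ℕ) [Fact ℓ.Prime], W.HasMultiplicativeReductionAtPrime ℓ → ¬ p ∣ padicValInt ℓ W.minimalDiscriminantInt)
    (htwo : ∃ (ℓ₁ ℓ₂ : ℕ) (_ : Fact ℓ₁.Prime) (_ : Fact ℓ₂.Prime), ℓ₁ ≠ ℓ₂ ∧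
      W.HasMultiplicativeReductionAtPrime ℓ₁ ∧ W.HasMultiplicativeReductionAtPrime ℓ₂)
    (htam : ¬ p ∣ W.tamagawaProduct) (hr : W.analyticRank = 1) (hK : IsImaginaryQuadratic K) (hodd : Odd (NumberField.discr K))
    (hlt : NumberField.discr K < -4) (hH : SatisfiesHeegnerHypothesis (W.conductorNorm ℤ) K)
    (hL : (W.quadraticTwist (NumberField.discr K : ℚ)).entireLFunction 1 ≠ 0)
    (hβ : (4 * (W.conductorNorm ℤ : ℤ)) ∣ β ^ 2 - NumberField.discr K) (hc : ¬ (p : ℤ) ∣ Dt.c)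
    (hcert : ∃ (ιp : K →+* ℚ_[p]) (H : HeegnerDatum (W.conductorNorm ℤ) (NumberField.discr K))
      (y : (W.baseChange K).toAffine.Point), H.β = β ∧
      WeierstrassCurve.Affine.Point.map ι.toRatAlgHom y = heegnerPointComplex Dt H ∧
        ¬ ∃ Q : (W.baseChange ℚ_[p]).toAffine.Point, (p : ℤ) • Q = X11b.padicPointOf W p ιp y)
    (c : K ≃ₐ[ℚ] K) (hc1 : c ≠ 1) [Module (ZMod p) (Vp W K p)] :
    Nonempty (LevelKolyvaginSystemP W K p Dt β ι c) :=
  nonempty_levelKolyvaginSystemP_of_kolyvaginClass_ne_zero_free W p K Dt β ι h5 hsurj hK hodd hlt hH hβ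
    (kolyvaginPrimitiveAdditive_conclusion_of_selfCertificate W p K Dt β ι h5 hadd hsurj hsp htwo htam hr hK hodd hlt hH hL hβ hc hcert)
    c hc1

/-- READING (no sorry, no named fact): S1‴ ↔ crux r2 KPA′ — the registered residual of item 21396 IS item 21400, by name, with no input. -/
theorem stub_kolyvaginPrimitiveAboveBottom_iff_kolyvaginPrimitiveAdditive :
    (∀ (W : WeierstrassCurve ℚ) [W.IsElliptic] [W.IsGloballyMinimal] [NeZero (W.conductorNorm ℤ)]
      (p : ℕ) [Fact p.Prime] (K : Type) [Field K] [NumberField K]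
      (Dt : ModularParametrizationData W (W.conductorNorm ℤ)) (β : ℤ) (ι : K →+* ℂ),
      5 ≤ p → Addv W p → W.HasSurjectiveModNGaloisRep p →
      (∀ (ℓ : ℕ) [Fact ℓ.Prime], W.HasMultiplicativeReductionAtPrime ℓ → ¬ p ∣ padicValInt ℓ W.minimalDiscriminantInt) →
      (∃ (ℓ₁ ℓ₂ : ℕ) (_ : Fact ℓ₁.Prime) (_ : Fact ℓ₂.Prime), ℓ₁ ≠ ℓ₂ ∧
        W.HasMultiplicativeReductionAtPrime ℓ₁ ∧ W.HasMultiplicativeReductionAtPrime ℓ₂) →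
      ¬ p ∣ W.tamagawaProduct → W.analyticRank = 1 → IsImaginaryQuadratic K → Odd (NumberField.discr K) →
      NumberField.discr K < -4 → SatisfiesHeegnerHypothesis (W.conductorNorm ℤ) K →
      (W.quadraticTwist (NumberField.discr K : ℚ)).entireLFunction 1 ≠ 0 →
      (4 * (W.conductorNorm ℤ : ℤ)) ∣ β ^ 2 - NumberField.discr K → ¬ (p : ℤ) ∣ Dt.c →
      (∀ d₁ : KolyvaginHeegnerData Dt β ι 1, d₁.kolyvaginClass (Fact.out : p.Prime) 1 = 0) →
      ∃ (n : ℕ) (d : KolyvaginHeegnerData Dt β ι n),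
        KolyvaginDescent.KolSupp (Zhang2014.IsKolyvaginPrime (W.conductorNorm ℤ) W K p) n ∧
          d.kolyvaginClass (Fact.out : p.Prime) 1 ≠ 0) ↔
    KolyvaginPrimitiveAdditive :=
  ⟨kolyvaginPrimitiveAdditive_of_stub, fun h W _ _ _ p _ K _ _ Dt β ι ↦
    stub_kolyvaginPrimitiveAboveBottom_of_kolyvaginPrimitiveAdditive h W p K Dt β ι⟩

end Summit.BirchSwinnertonDyer.BirchSwinnertonDyer.Cruxes.LevelKolyvaginSystemsAdditive.EpsilonMatchedRetyping

end
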